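import Summits.ResolutionOfSingularities.ResolutionOfSingularities.Theorems.EquisingularLiftEquisingularLiftNatDeltaConeLiftPlane
import Mathlib
import HarnessLib

/-!
# [OURS · L1 W4.5(b)] T-ΔLIFT-CENTRED-SQF (1/2) — square-freeness survives the blow-up substitution
# `βᵢ : X_i ↦ X_i, X_j ↦ X_i X_j` (crux `EquisingularLiftNatThree` = stmt-ResolutionOfSingularities-20148, parent
# `EquisingularLiftNat` = stmt-20038; rung v7 (TC⁺), ring input of T-ΔLIFT-CENTRED)

NOT a statement of any manuscript. Helper file of the chain res-L1-w45b (cell `res-hironaka`, rung L, slot W4.5(b));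
AI-written, weaker than expert review; filed `--supports stmt-ResolutionOfSingularities-20148 --as helper`; it closes nothing.

WHERE IT SITS. res-L1-w45b-lead-2's rung v7 (TC⁺) of `stub_elnat_three_isolated_nontc` sections ONE singular point `q` of
the reduced tangent-cone trace `Z = V(g) ⊂ e ≅ ℙ²_k` and lifts `g` CENTRED at the section over `q` (res-L1-w45b-stub-1's
T-ΔLIFT-CENTRED, STATUS 2026-08-27T10:18:29Z), which takes as HYPOTHESES that the strict transforms `gu, gv` of `g` on the two
charts of the blow-up of the `q`-chart have finite bad sets `{𝔮 | gu ∈ 𝔮, gu ∈ 𝔪_𝔮²}`. Part 2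
(`…NatStrictTransformSquarefree`) discharges them from reducedness of the trace and exact multiplicity at `q`; this part is
its pure-algebra core, for any set of variables `σ` over a field `k` (no scheme appears):

* the blow-up substitution of `𝔸^σ` at the origin on the chart of `X_i`, written INLINE as
  `aeval (fun j => if j = i then X i else X i * X j)` (no definition is introduced);
* `aeval_blowupSubst_injective` — it is injective (`X_i ↦ X_i`, `X_j ↦ X_j / X_i` into the fraction field is a left inverse);
* `exists_X_pow_mul_eq_aeval_blowupSubst` — `X_i^N · q` lies in its image for `N ≫ 0`;
* **`squarefree_of_aeval_blowupSubst_eq`** — `Squarefree g₀`, `βᵢ g₀ = X_i^m · gu`, `X_i ∤ gu` ⟹ `Squarefree gu`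
  (UFD `k[X_σ]`: a square factor `p² ∣ gu` pulls back, after clearing a power of `X_i`, to a square dividing `X_i^M · g₀`;
  its `X_i`-free part divides `g₀`, so is a unit; the remaining power of `X_i` is excluded by `X_i ∤ gu`).

References: folklore (unique factorisation in polynomial rings over a field); res-L1-w45b-stub-1 STATUS 2026-08-27T10:18:29Z
(OURS planning text, index only).
-/

set_option linter.dupNamespace false -- mandated namespace `Summit.<Summit>.<Problem>` of this single-conjunct summit

noncomputable section

namespace Summit.ResolutionOfSingularities.ResolutionOfSingularities.Cruxes.EquisingularLiftNat.Sections

open MvPolynomial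

universe u v

/-! ## The blow-up substitution `βᵢ : X_i ↦ X_i, X_j ↦ X_i·X_j` -/

section BlowupSubst

variable {k : Type u} [Field k] {σ : Type v} [DecidableEq σ] (i : σ)

/-- `βᵢ (X_i) = X_i`. [folklore] -/
theorem aeval_blowupSubst_X_self :
    aeval (fun j => if j = i then (X i : MvPolynomial σ k) else X i * X j) (X i : MvPolynomial σ k) = X i := by
  rw [aeval_X, if_pos rfl]

/-- `βᵢ (X_j) = X_i · X_j` for `j ≠ i`. [folklore] -/
theorem aeval_blowupSubst_X_of_ne {j : σ} (h : j ≠ i) :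
    aeval (fun j => if j = i then (X i : MvPolynomial σ k) else X i * X j) (X j : MvPolynomial σ k) = X i * X j := by
  rw [aeval_X, if_neg h]

/-- `βᵢ (X_i^n) = X_i^n`. [folklore] -/
theorem aeval_blowupSubst_X_self_pow (n : ℕ) :
    aeval (fun j => if j = i then (X i : MvPolynomial σ k) else X i * X j) (X i ^ n : MvPolynomial σ k) = X i ^ n := by
  rw [map_pow, aeval_blowupSubst_X_self]

/-- **The blow-up substitution is injective**: `X_i ↦ X_i`, `X_j ↦ X_j / X_i` into the fraction field is a left
inverse. [folklore] [OURS · L1 W4.5b] -/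
theorem aeval_blowupSubst_injective :
    Function.Injective
      (aeval (fun j => if j = i then (X i : MvPolynomial σ k) else X i * X j) :
        MvPolynomial σ k →ₐ[k] MvPolynomial σ k) := by
  let A := MvPolynomial σ k
  let K := FractionRing A
  have hX0 : algebraMap A K (X i) ≠ 0 := by
    rw [Ne, IsFractionRing.to_map_eq_zero_iff]
    exact X_ne_zero i
  let γ : A →ₐ[k] K := aeval fun j => if j = i then algebraMap A K (X i) else algebraMap A K (X j) / algebraMap A K (X i)
  have hcomp : γ.comp (aeval (fun j => if j = i then (X i : MvPolynomial σ k) else X i * X j)) =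
      IsScalarTower.toAlgHom k A K := by
    refine algHom_ext fun j => ?_
    rw [AlgHom.comp_apply, IsScalarTower.toAlgHom_apply]
    by_cases hj : j = i
    · subst hj
      rw [aeval_blowupSubst_X_self, show γ (X j) = _ from aeval_X _ j, if_pos rfl]
    · rw [aeval_blowupSubst_X_of_ne i hj, map_mul, show γ (X i) = _ from aeval_X _ i, if_pos rfl,
        show γ (X j) = _ from aeval_X _ j, if_neg hj, mul_div_cancel₀ _ hX0]
  have hinj : Function.Injective (γ ∘ (aeval (fun j => if j = i then (X i : MvPolynomial σ k) else X i * X j) :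
      MvPolynomial σ k →ₐ[k] MvPolynomial σ k)) := by
    rw [← AlgHom.coe_comp, hcomp]
    exact IsFractionRing.injective A K
  exact hinj.of_comp

/-- **Every polynomial lies in the image of `βᵢ` after multiplication by a power of `X_i`**
(`X_i^a X^b ↦ X_i^{a+|b|} X^b`; the monomial `X_i^c X^b` is hit as soon as `c ≥ |b|`). [folklore] [OURS · L1 W4.5b] -/
theorem exists_X_pow_mul_eq_aeval_blowupSubst (q : MvPolynomial σ k) :
    ∃ (N : ℕ) (q' : MvPolynomial σ k),
      X i ^ N * q = aeval (fun j => if j = i then (X i : MvPolynomial σ k) else X i * X j) q' := by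
  induction q using MvPolynomial.induction_on with
  | C a => exact ⟨0, C a, by rw [pow_zero, one_mul, aeval_C, algebraMap_eq]⟩
  | add p q hp hq =>
    obtain ⟨N₁, p', hp'⟩ := hp
    obtain ⟨N₂, q', hq'⟩ := hq
    refine ⟨N₁ + N₂, X i ^ N₂ * p' + X i ^ N₁ * q', ?_⟩
    rw [map_add, map_mul, map_mul, aeval_blowupSubst_X_self_pow, aeval_blowupSubst_X_self_pow, ← hp', ← hq']
    ring
  | mul_X p j hp =>
    obtain ⟨N, p', hp'⟩ := hp
    by_cases hj : j = i
    · subst hj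
      refine ⟨N, p' * X j, ?_⟩
      rw [map_mul, aeval_blowupSubst_X_self, ← hp', mul_assoc]
    · refine ⟨N + 1, p' * X j, ?_⟩
      rw [map_mul, aeval_blowupSubst_X_of_ne i hj, ← hp']
      ring

/-- **CORE — square-freeness survives the strict transform.** In `k[X_σ]` (`k` a field, so a UFD): if `g₀` is
square-free, `βᵢ g₀ = X_i^m · gu` and `X_i ∤ gu`, then `gu` is square-free. [folklore] [OURS · L1 W4.5b] -/
theorem squarefree_of_aeval_blowupSubst_eq {g₀ gu : MvPolynomial σ k} {m : ℕ} (hsq : Squarefree g₀)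
    (hu : aeval (fun j => if j = i then (X i : MvPolynomial σ k) else X i * X j) g₀ = X i ^ m * gu)
    (hX : ¬ X i ∣ gu) : Squarefree gu := by
  classical
  set β : MvPolynomial σ k →ₐ[k] MvPolynomial σ k :=
    aeval (fun j => if j = i then (X i : MvPolynomial σ k) else X i * X j) with hβ
  have hXp : Prime (X i : MvPolynomial σ k) := X_prime
  have hX0 : (X i : MvPolynomial σ k) ≠ 0 := X_ne_zero i
  intro p hp
  obtain ⟨r, hr⟩ := hp
  have hgu0 : gu ≠ 0 := fun h => hX (h ▸ dvd_zero _)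
  have hp0 : p ≠ 0 := by
    rintro rfl
    exact hgu0 (by rw [hr, zero_mul, zero_mul])
  obtain ⟨N, p', hp'⟩ := exists_X_pow_mul_eq_aeval_blowupSubst i p
  obtain ⟨N', r', hr'⟩ := exists_X_pow_mul_eq_aeval_blowupSubst i r
  have hp'0 : p' ≠ 0 := by
    rintro rfl
    rw [map_zero] at hp'
    exact hp0 ((mul_eq_zero.mp hp').resolve_left (pow_ne_zero N hX0))
  -- pull the factorisation back along `β`
  have key : β (X i ^ (N + N + N') * g₀) = β (X i ^ m * (p' * p' * r')) := by
    rw [map_mul, aeval_blowupSubst_X_self_pow, hu, map_mul, aeval_blowupSubst_X_self_pow, map_mul, map_mul,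
      ← hp', ← hr', hr]
    ring
  have key' : X i ^ (N + N + N') * g₀ = X i ^ m * (p' * p' * r') := aeval_blowupSubst_injective i key
  -- split off the `X_i`-power of `p'`
  obtain ⟨e, p'', hp''X, rfl⟩ := WfDvdMonoid.max_power_factor hp'0 hXp.irreducible
  have hp''0 : p'' ≠ 0 := right_ne_zero_of_mul hp'0
  have hdvd : p'' * p'' ∣ X i ^ (N + N + N') * g₀ := by
    rw [key']
    exact ⟨X i ^ m * (X i ^ e * X i ^ e * r'), by ring⟩
  -- `p''²` and `X_i^M` have no common prime factor, so `p''² ∣ g₀`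
  have hdvd' : p'' * p'' ∣ g₀ := by
    refine UniqueFactorizationMonoid.dvd_of_dvd_mul_right_of_no_prime_factors (mul_ne_zero hp''0 hp''0) ?_ hdvd
    intro d hd hdX hdprime
    have hdXi : d ∣ X i := hdprime.dvd_of_dvd_pow hdX
    have hXd : X i ∣ d := hdprime.irreducible.dvd_symm hXp.irreducible hdXi
    exact hp''X ((hXp.dvd_or_dvd (hXd.trans hd)).elim id id)
  have hunit : IsUnit p'' := hsq p'' hdvd'
  have hβunit : IsUnit (β p'') := hunit.map β
  -- `X_i^N · p = X_i^e · (unit)`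
  have hrel : X i ^ N * p = X i ^ e * β p'' := by rw [hp', map_mul, aeval_blowupSubst_X_self_pow]
  rcases le_or_gt N e with hNe | hNe
  · obtain ⟨t, rfl⟩ := Nat.exists_eq_add_of_le hNe
    have hpt : p = X i ^ t * β p'' := by
      rw [pow_add, mul_assoc] at hrel
      exact mul_left_cancel₀ (pow_ne_zero N hX0) hrel
    cases t with
    | zero => rw [hpt, pow_zero, one_mul]; exact hβunit
    | succ t =>
      exfalso
      apply hX
      have : X i ∣ p := ⟨X i ^ t * β p'', by rw [hpt]; ring⟩
      exact this.trans ⟨p * r, by rw [hr]; ring⟩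
  · exfalso
    obtain ⟨t, rfl⟩ := Nat.exists_eq_add_of_lt hNe
    have hpt : X i ^ (t + 1) * p = β p'' := by
      rw [show e + t + 1 = e + (t + 1) by ring, pow_add, mul_assoc] at hrel
      exact mul_left_cancel₀ (pow_ne_zero e hX0) hrel
    have : X i ∣ β p'' := ⟨X i ^ t * p, by rw [← hpt]; ring⟩
    exact hXp.not_unit (isUnit_of_dvd_unit this hβunit)

end BlowupSubst

end Summit.ResolutionOfSingularities.ResolutionOfSingularities.Cruxes.EquisingularLiftNat.Sections

end
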